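import Summits.ABC.IUTFork.LDHSlotRegimePointTransport
import Summits.ABC.IUTFork.LDHSlotResidueMixedShare
import HarnessLib

/-!
# The fork at [IUTchIII] Corollary 3.12, L-DH level, READING (U): the NECESSITY half of the Szpiro-type certificate READ ON THE
# POINT in the mixed-height currency — `hvol(λ, l)` FORCES «weighted bad local height of `j(λ)` at each mixed prime of `ℚ(j(λ))`,
# up to the (Ind1)-tail, `≤ B_III(λ, l)`», datum-free (abc-iut cell, R2 S-chain team seat abc-iut-s2-p1; crux ThetaPartII =
# stmt-ABC-19678; CONE binder `hvol` / `hreg` of `abc_of_S_v3` / `abc_of_S_v4`)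

Record-only PROOF file (D-0012) of the abc-iut cell; TAKES NO SIDE on [IUTchIII] Cor. 3.12 or on the (U)/(P) readings of
"−|log(Θ)|". Mochizuki, *Inter-universal Teichmüller theory IV* (RIMS manuscript Apr. 2020 = PRIMS **57** (2021)), Thm. 1.10 proof
Step (v) pp. 27–28 (symmetrisation in `i† ∈ I`), Cor. 2.2 (ii) proof p. 46 ((P5), (P7)); Dupuy–Hilado [DupuyHilado2025] §3.3, §3.6,
§4.7, §4.11–4.12.

abc-iut-s2-p2's `PointDict.mixedShare_le_of_hullVolumeAtDatum` / `localHeightShare_le_of_hullVolumeAtDatum` (over abc-iut-S8's forced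
slot residue) state the necessity ON THE DATUM (`F_mod(E_F)`, `𝕍^bad_mod(T.D)`). With the transport of `LDHSlotRegimePointTransport`
(abc-iut-s2-p1, over abc-iut-s2-p5's `range_algebraMap_adjoin_jInv_eq`) this file reads them ON THE POINT, in the currency of the
SUFFICIENCY half `LDHGenuineHullRegimeMixedPoint`: `F_mod := ℚ(j(λ)) ⊆ F_tpd`; `V` (P5)-bad iff `ord_V j(λ) < 0`, `V ∤ 2`, `V ∤ l`;
`h♭(V) := (−ord_V j(λ))·log N(V)/n_V` at bad `V`, else `0`; `S(p) := Σ_{V|p bad} Pr(V)·h♭(V)`; `ω_p := Σ_{V|p not bad} Pr(V)` (all inline).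

* `PointDict.sum_goodWeight_eq_point` — `ω_p` of the datum (`Σ_{v|p, v∉𝕍^bad_mod} Pr(v)` over `F_mod(E_F)`) = `ω_p` of the point;
* `PointDict.sum_badHeight_mul_weight_eq_point_div` — s2-p2's inner sum `Σ_{v|p} 𝟙[bad]·(−ord_v j_E)/(2l)·ln N(v)/n_v·Pr(v) = S(p)/(2l)`;
* **`PointDict.pointMixedShare_le_of_hullVolumeAtDatum`** — `Cor22.HullVolumeAtDatum P l δ` + a datum ⟹ for every finite set `W` of
  primes with `ω_p > 0` (p ∈ W): `Σ_{p∈W} (S(p)/(2l))·(l(l+1)/12 − 4(1−ω_p)/((l−1)ω_p³)) ≤ δ` — NO datum in the conclusion;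
* **`PointDict.pointMixedShare_le_BIII_of_hvol`** — from `abc_of_S_v3`'s CONE binder `hvol` VERBATIM, at every admissible `(λ, l)`
  (datum by abc-iut-L5-t7's `ThetaPartII.stub_thetaData`), with `δ = B_III(λ,l)`.

READING (for the planners; nothing asserted about print). Together with `hullVolumeAtDatum_BIII_of_pointMixedHeight_le_szpiroMax` the CONE
binder is SANDWICHED DATUM-FREE on the SAME sums `S(p)`: «((l+1)/24)·Σ_{p mixed} S(p) ≤ (Step (iii)/(viii) slack of B_III)» ⟹ `hvol(λ,l)` ⟹
«Σ_{p∈W} (S(p)/(2l))·(l(l+1)/12 − tail_p) ≤ B_III(λ,l)» for every `W` of primes under a non-bad place (`(1/(2l))·l(l+1)/12 = (l+1)/24`;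
`tail_p → 0` as `l → ∞`). HONEST SCOPE: compositions and transport bookkeeping; no datum constructed; no side taken on Cor. 3.12 / Thm. 1.10
or on any author; typed ≠ proved. PROOF-ONLY file: no definitions, no named `Prop` facts.
[cite: Mochizuki2012, IUTchIV Thm. 1.10 proof Step (v) p. 27–28] [cite: Mochizuki2012, IUTchIV Cor. 2.2 (ii) proof p. 46]
[cite: DupuyHilado2025, §3.3, §3.6, §4.7, §4.12] [claim: Mochizuki2012, status: disputed] for every IUT quotation.
-/

noncomputable section

namespace Summit.ABC.IUTFork

open NumberField IsDedekindDomain Literature.IUT.LogVolume Literature.IUT.HodgeTheaters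
open Literature.NumberTheory.DiophantineGeometry.GenEll
open scoped Classical

namespace PointDict

variable {P : NFPoint} {l : ℕ}

/-- **`ω_p` transported to the point**: for a genuine Θ-volume datum `T` at `(P, l)` and a prime `p`, the total weight of the
places of `F_mod(E_F)` above `p` OUTSIDE `𝕍^bad_mod(T.D)` equals the total weight of the places of `ℚ(j(λ))` above `p` that are
NOT (P5)-bad (weight descent to `F` twice; badness by `finBelow_mem_badPrimesMod_iff`). [cite: DupuyHilado2025, §3.6]
[cite: NeukirchANT1999, Ch. I §8 Prop. (8.2)] [claim: Mochizuki2012, status: disputed] -/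
theorem sum_goodWeight_eq_point (T : Cor22.ThetaVolumeDatumAt P l) (p : ℕ) [Fact p.Prime] :
    (letI := T.instFieldF; letI := T.instNumberFieldF; letI := T.instAlgebraF; letI := T.instFieldK
     letI := T.instNumberFieldK; letI := T.instAlgebraK; letI := T.instFieldFbar; letI := T.instAlgebraFbar
     letI := T.instAlgebraKFbar; letI := T.instIsElliptic
     ∑ v ∈ Finset.univ.filter (fun v : placesOver ↥(fieldOfModuli T.E) p => v.1 ∉ ThetaData.badPrimesMod T.D),
        weight ↥(fieldOfModuli T.E) v.1) =
      ∑ V ∈ Finset.univ.filter (fun V : placesOver ↥(IntermediateField.adjoin ℚ ({Cor22.jInv P.x} : Set P.F)) p =>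
          ¬ (ord _ V.1 (Cor22.jMod P) < 0 ∧ ((2 : ℕ) : 𝓞 _) ∉ V.1.asIdeal ∧ ((l : ℕ) : 𝓞 _) ∉ V.1.asIdeal)),
        weight _ V.1 := by
  letI := T.instFieldF; letI := T.instNumberFieldF; letI := T.instAlgebraF; letI := T.instFieldK
  letI := T.instNumberFieldK; letI := T.instAlgebraK; letI := T.instFieldFbar; letI := T.instAlgebraFbar
  letI := T.instAlgebraKFbar; letI := T.instIsElliptic
  set Fm : Type := ↥(IntermediateField.adjoin ℚ ({Cor22.jInv P.x} : Set P.F)) with hFm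
  letI : Algebra Fm T.F := ((algebraMap P.F T.F).comp (algebraMap Fm P.F)).toAlgebra
  set FE : Type := ↥(fieldOfModuli T.E) with hFE
  -- the fibre-constant indicator on the places of `F` above `p`
  set f : placesOver T.F p → ℝ := fun x =>
    if finBelow FE T.F x.1 ∈ ThetaData.badPrimesMod T.D then 0 else 1 with hf
  have hfib : ∀ x x' : placesOver T.F p, finBelow FE T.F x.1 = finBelow FE T.F x'.1 → f x = f x' := by
    intro x x' h
    simp only [hf, h]
  obtain ⟨sE, hsE⟩ := exists_section_placesOver FE T.F p
  obtain ⟨sP, hsP⟩ := exists_section_placesOver Fm T.F p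
  have hE : ∑ v ∈ Finset.univ.filter (fun v : placesOver FE p => v.1 ∉ ThetaData.badPrimesMod T.D), weight FE v.1 =
      ∑ x : placesOver T.F p, weight T.F x.1 * f x := by
    rw [sum_weight_mul_eq_of_fibreConst FE T.F f sE hsE hfib, Finset.sum_filter]
    refine Finset.sum_congr rfl fun v _ => ?_
    simp only [hf, hsE v]
    split_ifs <;> simp
  have hP' : ∑ V ∈ Finset.univ.filter (fun V : placesOver Fm p =>
        ¬ (ord Fm V.1 (Cor22.jMod P) < 0 ∧ ((2 : ℕ) : 𝓞 Fm) ∉ V.1.asIdeal ∧ ((l : ℕ) : 𝓞 Fm) ∉ V.1.asIdeal)),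
        weight Fm V.1 = ∑ x : placesOver T.F p, weight T.F x.1 * f x := by
    rw [sum_weight_mul_eq_of_fibreConst Fm T.F f sP hsP (fun x x' h => hfib x x'
      ((finBelow_eq_iff_of_range_eq (range_algebraMap_adjoin_jInv_eq T) x.1 x'.1).mp h)), Finset.sum_filter]
    refine Finset.sum_congr rfl fun V _ => ?_
    have hiff := finBelow_mem_badPrimesMod_iff T (sP V).1
    simp only [hf]
    rw [hsP V] at hiff
    by_cases hb : finBelow FE T.F (sP V).1 ∈ ThetaData.badPrimesMod T.D
    · rw [if_pos hb, if_neg (not_not.mpr (hiff.mp hb))]; simp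
    · rw [if_neg hb, if_pos (fun h => hb (hiff.mpr h))]; simp
  rw [hE, hP']

/-- **abc-iut-s2-p2's inner sum is `S(p)/(2l)` on the point**: for a genuine Θ-volume datum `T` at `(P, l)` and a prime `p`,
`Σ_{v|p} 𝟙[v ∈ 𝕍^bad_mod]·(−ord_v j_E)/(2l)·ln N(v)/n_v·Pr(v)` (over `F_mod(E_F)`) `= (1/(2l))·Σ_{V|p bad} Pr(V)·h♭(V)` (over
`ℚ(j(λ))`; `sum_badHeight_weight_eq_point`). [cite: DupuyHilado2025, §3.3, §3.6] [claim: Mochizuki2012, status: disputed] -/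
theorem sum_badHeight_mul_weight_eq_point_div (T : Cor22.ThetaVolumeDatumAt P l) (p : ℕ) [Fact p.Prime] :
    (letI := T.instFieldF; letI := T.instNumberFieldF; letI := T.instAlgebraF; letI := T.instFieldK
     letI := T.instNumberFieldK; letI := T.instAlgebraK; letI := T.instFieldFbar; letI := T.instAlgebraFbar
     letI := T.instAlgebraKFbar; letI := T.instIsElliptic
     ∑ v : placesOver ↥(fieldOfModuli T.E) p,
        (if v.1 ∈ ThetaData.badPrimesMod T.D then
            ((-ord ↥(fieldOfModuli T.E) v.1 (ThetaData.jMod T.E) : ℤ) : ℝ) / (2 * (l : ℝ)) *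
              logNorm ↥(fieldOfModuli T.E) v.1 / (localDegree ↥(fieldOfModuli T.E) v.1 : ℝ)
         else 0) * weight ↥(fieldOfModuli T.E) v.1) =
      1 / (2 * (l : ℝ)) * ∑ V : placesOver ↥(IntermediateField.adjoin ℚ ({Cor22.jInv P.x} : Set P.F)) p,
        (if ord _ V.1 (Cor22.jMod P) < 0 ∧ ((2 : ℕ) : 𝓞 _) ∉ V.1.asIdeal ∧ ((l : ℕ) : 𝓞 _) ∉ V.1.asIdeal then
          weight _ V.1 * (((-ord _ V.1 (Cor22.jMod P) : ℤ) : ℝ) * logNorm _ V.1 / (localDegree _ V.1 : ℝ))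
         else 0) := by
  letI := T.instFieldF; letI := T.instNumberFieldF; letI := T.instAlgebraF; letI := T.instFieldK
  letI := T.instNumberFieldK; letI := T.instAlgebraK; letI := T.instFieldFbar; letI := T.instAlgebraFbar
  letI := T.instAlgebraKFbar; letI := T.instIsElliptic
  rw [← sum_badHeight_weight_eq_point T p, Finset.mul_sum]
  refine Finset.sum_congr rfl fun v _ => ?_
  split_ifs <;> ring

/-- **NECESSITY ON THE POINT.** `Cor22.HullVolumeAtDatum P l δ` (the conclusion of the CONE binder `hvol` / the stubs `stub_hullVolume`,
`stub_hullRegime`) and a genuine Θ-volume datum `T` at `(P, l)` force, for every finite set `W` of primes each under a non-(P5)-bad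
place of `ℚ(j(λ))` of positive total weight `ω_p`:
`Σ_{p∈W} (S(p)/(2l))·(l(l+1)/12 − 4(1−ω_p)/((l−1)·ω_p³)) ≤ δ` — abc-iut-s2-p2's `mixedShare_le_of_hullVolumeAtDatum` transported by
`sum_goodWeight_eq_point` / `sum_badHeight_mul_weight_eq_point_div`. The conclusion mentions NO datum and NO IUT object.
[cite: Mochizuki2012, IUTchIV Thm. 1.10 proof Step (v) p. 27–28] [cite: DupuyHilado2025, §3.3, §3.6, §4.7, §4.12]
[claim: Mochizuki2012, status: disputed] -/
theorem pointMixedShare_le_of_hullVolumeAtDatum {δ : ℝ} (h : Cor22.HullVolumeAtDatum P l δ) (T : Cor22.ThetaVolumeDatumAt P l)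
    (W : Finset ℕ) (hW : ∀ p ∈ W, p.Prime)
    (hω : ∀ p ∈ W, 0 < ∑ V ∈ Finset.univ.filter
        (fun V : placesOver ↥(IntermediateField.adjoin ℚ ({Cor22.jInv P.x} : Set P.F)) p =>
          ¬ (ord _ V.1 (Cor22.jMod P) < 0 ∧ ((2 : ℕ) : 𝓞 _) ∉ V.1.asIdeal ∧ ((l : ℕ) : 𝓞 _) ∉ V.1.asIdeal)),
        weight _ V.1) :
    ∑ p ∈ W, (1 / (2 * (l : ℝ)) * ∑ V : placesOver ↥(IntermediateField.adjoin ℚ ({Cor22.jInv P.x} : Set P.F)) p,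
        (if ord _ V.1 (Cor22.jMod P) < 0 ∧ ((2 : ℕ) : 𝓞 _) ∉ V.1.asIdeal ∧ ((l : ℕ) : 𝓞 _) ∉ V.1.asIdeal then
          weight _ V.1 * (((-ord _ V.1 (Cor22.jMod P) : ℤ) : ℝ) * logNorm _ V.1 / (localDegree _ V.1 : ℝ))
         else 0)) *
      ((l : ℝ) * ((l : ℝ) + 1) / 12
        - 4 * (1 - ∑ V ∈ Finset.univ.filter
              (fun V : placesOver ↥(IntermediateField.adjoin ℚ ({Cor22.jInv P.x} : Set P.F)) p =>
                ¬ (ord _ V.1 (Cor22.jMod P) < 0 ∧ ((2 : ℕ) : 𝓞 _) ∉ V.1.asIdeal ∧ ((l : ℕ) : 𝓞 _) ∉ V.1.asIdeal)),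
              weight _ V.1) /
          (((l : ℝ) - 1) * (∑ V ∈ Finset.univ.filter
              (fun V : placesOver ↥(IntermediateField.adjoin ℚ ({Cor22.jInv P.x} : Set P.F)) p =>
                ¬ (ord _ V.1 (Cor22.jMod P) < 0 ∧ ((2 : ℕ) : 𝓞 _) ∉ V.1.asIdeal ∧ ((l : ℕ) : 𝓞 _) ∉ V.1.asIdeal)),
              weight _ V.1) ^ 3)) ≤ δ := by
  letI := T.instFieldF; letI := T.instNumberFieldF; letI := T.instAlgebraF; letI := T.instFieldK
  letI := T.instNumberFieldK; letI := T.instAlgebraK; letI := T.instFieldFbar; letI := T.instAlgebraFbar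
  letI := T.instAlgebraKFbar; letI := T.instIsElliptic
  have hω' : ∀ p ∈ W, 0 < ∑ v ∈ Finset.univ.filter
      (fun v : placesOver ↥(fieldOfModuli T.E) p => v.1 ∉ ThetaData.badPrimesMod T.D), weight ↥(fieldOfModuli T.E) v.1 := by
    intro p hp
    haveI : Fact p.Prime := ⟨hW p hp⟩
    rw [sum_goodWeight_eq_point T p]
    exact hω p hp
  have hs2 := mixedShare_le_of_hullVolumeAtDatum h T W hW hω'
  refine le_of_eq_of_le ?_ hs2
  refine Finset.sum_congr rfl fun p hp => ?_
  haveI : Fact p.Prime := ⟨hW p hp⟩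
  rw [sum_badHeight_mul_weight_eq_point_div T p, sum_goodWeight_eq_point T p]

/-- **NECESSITY ON THE POINT, FROM THE CONE BINDER.** From `abc_of_S_v3`'s `hvol` VERBATIM: at every admissible `(λ, l)` (`λ ∈ U_X`
minimal, `l` prime `≥ 5`, «admits an `F`-core», (P2), (P5), (P6) — a datum exists by abc-iut-L5-t7's `ThetaPartII.stub_thetaData`) and
every finite set `W` of primes each under a non-(P5)-bad place of `ℚ(j(λ))` of positive weight `ω_p`:
`Σ_{p∈W} (S(p)/(2l))·(l(l+1)/12 − 4(1−ω_p)/((l−1)·ω_p³)) ≤ B_III(λ, l)` — an abc/Szpiro-type inequality on the `Pr`-weighted local heights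
of `j(λ)` at the mixed primes, datum-free and IUT-free. [cite: Mochizuki2012, IUTchIV Thm. 1.10 proof Step (v) p. 27–28]
[cite: Mochizuki2012, IUTchIV Cor. 2.2 (ii) proof p. 46] [claim: Mochizuki2012, status: disputed] -/
theorem pointMixedShare_le_BIII_of_hvol
    (hvol : ∀ P₀ : NFPoint, P₀ ∈ UP → ∀ l : ℕ, l.Prime → 5 ≤ l →
      Cor22.AdmitsCore P₀ → Cor22.CondP2 P₀ l → Cor22.CondP5 P₀ l → Cor22.CondP6 P₀ l →
        Cor22.HullVolumeAtDatum P₀ l (((l : ℝ) + 1) / 4 *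
          ((1 + 12 * (Cor22.dmod P₀ : ℝ) / l) * (P₀.logDiff + Cor22.logCondAvoid P₀ {2, l})
            + 2 * Real.log l + 52
            + 20 / 3 * Real.log (((2 ^ 12 * 3 ^ 3 * 5 * Cor22.dmod P₀ : ℕ) : ℝ) * (l : ℝ))
              * (Nat.primeCounting (2 ^ 12 * 3 ^ 3 * 5 * Cor22.dmod P₀ * l) : ℝ))))
    (hP : P ∈ UP) (hl : l.Prime) (h5 : 5 ≤ l) (hcore : Cor22.AdmitsCore P) (h2 : Cor22.CondP2 P l)
    (h5' : Cor22.CondP5 P l) (h6 : Cor22.CondP6 P l)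
    (W : Finset ℕ) (hW : ∀ p ∈ W, p.Prime)
    (hω : ∀ p ∈ W, 0 < ∑ V ∈ Finset.univ.filter
        (fun V : placesOver ↥(IntermediateField.adjoin ℚ ({Cor22.jInv P.x} : Set P.F)) p =>
          ¬ (ord _ V.1 (Cor22.jMod P) < 0 ∧ ((2 : ℕ) : 𝓞 _) ∉ V.1.asIdeal ∧ ((l : ℕ) : 𝓞 _) ∉ V.1.asIdeal)),
        weight _ V.1) :
    ∑ p ∈ W, (1 / (2 * (l : ℝ)) * ∑ V : placesOver ↥(IntermediateField.adjoin ℚ ({Cor22.jInv P.x} : Set P.F)) p,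
        (if ord _ V.1 (Cor22.jMod P) < 0 ∧ ((2 : ℕ) : 𝓞 _) ∉ V.1.asIdeal ∧ ((l : ℕ) : 𝓞 _) ∉ V.1.asIdeal then
          weight _ V.1 * (((-ord _ V.1 (Cor22.jMod P) : ℤ) : ℝ) * logNorm _ V.1 / (localDegree _ V.1 : ℝ))
         else 0)) *
      ((l : ℝ) * ((l : ℝ) + 1) / 12
        - 4 * (1 - ∑ V ∈ Finset.univ.filter
              (fun V : placesOver ↥(IntermediateField.adjoin ℚ ({Cor22.jInv P.x} : Set P.F)) p =>
                ¬ (ord _ V.1 (Cor22.jMod P) < 0 ∧ ((2 : ℕ) : 𝓞 _) ∉ V.1.asIdeal ∧ ((l : ℕ) : 𝓞 _) ∉ V.1.asIdeal)),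
              weight _ V.1) /
          (((l : ℝ) - 1) * (∑ V ∈ Finset.univ.filter
              (fun V : placesOver ↥(IntermediateField.adjoin ℚ ({Cor22.jInv P.x} : Set P.F)) p =>
                ¬ (ord _ V.1 (Cor22.jMod P) < 0 ∧ ((2 : ℕ) : 𝓞 _) ∉ V.1.asIdeal ∧ ((l : ℕ) : 𝓞 _) ∉ V.1.asIdeal)),
              weight _ V.1) ^ 3)) ≤
      ((l : ℝ) + 1) / 4 * ((1 + 12 * (Cor22.dmod P : ℝ) / l) * (P.logDiff + Cor22.logCondAvoid P {2, l})
        + 2 * Real.log l + 52 + 20 / 3 * Real.log (((2 ^ 12 * 3 ^ 3 * 5 * Cor22.dmod P : ℕ) : ℝ) * (l : ℝ))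
          * (Nat.primeCounting (2 ^ 12 * 3 ^ 3 * 5 * Cor22.dmod P * l) : ℝ)) := by
  obtain ⟨T⟩ := Summit.ABC.ABC.Theorems.ThetaPartII.stub_thetaData P hP l hl h5 hcore h2 h5' h6
  exact pointMixedShare_le_of_hullVolumeAtDatum (hvol P hP l hl h5 hcore h2 h5' h6) T W hW hω

end PointDict

end Summit.ABC.IUTFork

end
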